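import Summits.Parity.GeneralizedHardyLittlewood.Theorems.GreenTaoLevelTwoMNTwoBohrGauge

/-!
# Route `GreenTaoLevelTwo`, crux `MNTwo` (stmt-Parity-21276), line `birth`, stub `stub_mnVertical`:
# the parameters of the type II case at the budget scale (GT 2008b §10, end of the type II case)

Block H4 / R4-II (budget form, arithmetic) of the `stub_mnVertical` census (B. Green, T. Tao,
*Quadratic uniformity of the Möbius function*, Ann. Inst. Fourier 58 (2008) = arXiv:math/0606087,
§10: "In Lemma 24 take `L = M := εX^{1/2}/10` … If `X₀ ≲ 1` is sufficiently large and `X > X₀` then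
certainly the two conditions `L, M ≥ 1/ε` are satisfied").  Def-free, pure real arithmetic for
`…MNTwoTypeIIHalf`: with the budget `P = log^{A₀} N`, the scale `ρ₁ = P^{-(k+2)(4+4^{k+2})}`,
`σ = √ρ₁`, a level `η ≥ c·log^{-a} N`, `Q = C₂η^{-A₂}`, `ε' = min(η^{A₂}/C₂, ρ)` and the common
length `ℓ = ⌊ε'/(10σ)⌋`, all budget inequalities of `…MNTwoTypeIIBranch.prop22_of_typeII_core`
that do not involve the divisor level hold once `A₀ ≥ A₂'(a, A₂)` and `N ≥ N₂(A₀)`, together with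
the growth bound `4·16^{k+2}·32·38ᵏ·P^{(k+2)(4+4^{k+2})(k+1)} ≤ N^{1/4}` (`log^r x = o(x^{1/4})`).

* `typeII_params` — the statement just described.

References: [GreenTao2008QuadraticMobius] arXiv:math/0606087 §10 (end of the type II case).
-/

noncomputable section

open Finset Real Filter Asymptotics

namespace Summit.Parity.GeneralizedHardyLittlewood.GreenTaoLevelTwoMNTwoTypeIIParams

/-- **Parameters of the type II case at the budget scale.**  See the module docstring; the
outputs are, in order: `0 < η`, `0 < ρ₁`, `4ρ₁ ≤ P`, `Q ≤ P`, `Q ≤ P^{e(k+1)}`,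
`4·Kk·P^{e(k+1)} ≤ N^{1/4}`, and `ℓ, σ, x, ε'` with `1 ≤ ℓ`, `0 < σ`, `σ² = ρ₁`, `σ ≤ 1`,
`P^{-e(k+1)} ≤ σ`, `0 < ε' ≤ η^{A₂}/C₂`, `x = ε'/(10σ)`, `0 < x`, `ℓ ≤ x`, `Q ≤ ℓ`,
`ℓ²ρ₁ ≤ min(ε², ρ)`, `Q ≤ Pρ₁²ℓ⁴` (`e = (k+2)(4+4^{k+2})`, `Kk = 16^{k+2}·32·38ᵏ`).
[cite: GreenTao2008QuadraticMobius, §10 (end of the type II case)] -/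
theorem typeII_params (k A₂ : ℕ) {C₂ aη cη : ℝ} (hC₂ : 1 ≤ C₂) (haη : 0 < aη) (hcη : 0 < cη) :
    ∃ A₂' : ℝ, ∀ A₀ : ℝ, A₂' ≤ A₀ → ∃ N₂ : ℕ, ∀ N : ℕ, N₂ ≤ N → 2 ≤ N →
      ∀ (ρ η : ℝ), 0 < ρ → 100000 * ρ < 1 → (Real.log N ^ aη)⁻¹ ≤ ρ →
        cη * (Real.log N ^ aη)⁻¹ ≤ η → η ≤ 1 →
      ∀ ρ₁ : ℝ, ρ₁ = ((Real.log N ^ A₀) ^ ((k + 2) * (4 + 4 ^ (k + 2))))⁻¹ →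
      0 < η ∧ 0 < ρ₁ ∧ 4 * ρ₁ ≤ Real.log N ^ A₀ ∧ C₂ / η ^ A₂ ≤ Real.log N ^ A₀ ∧
      C₂ / η ^ A₂ ≤ (Real.log N ^ A₀) ^ ((k + 2) * (4 + 4 ^ (k + 2)) * (k + 1)) ∧
      4 * (16 ^ (k + 2) * (32 * 38 ^ k)) *
          (Real.log N ^ A₀) ^ ((k + 2) * (4 + 4 ^ (k + 2)) * (k + 1)) ≤
        (N : ℝ) ^ ((1 : ℝ) / 4) ∧
      ∃ (ℓ : ℕ) (σ x ε' : ℝ), 1 ≤ ℓ ∧ 0 < σ ∧ σ * σ = ρ₁ ∧ σ ≤ 1 ∧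
        ((Real.log N ^ A₀) ^ ((k + 2) * (4 + 4 ^ (k + 2)) * (k + 1)))⁻¹ ≤ σ ∧
        0 < ε' ∧ ε' ≤ η ^ A₂ / C₂ ∧ x = ε' / (10 * σ) ∧ 0 < x ∧ (ℓ : ℝ) ≤ x ∧
        C₂ / η ^ A₂ ≤ (ℓ : ℝ) ∧
        (ℓ : ℝ) ^ 2 * ρ₁ ≤ min ((η ^ A₂ / C₂) ^ 2) ρ ∧
        C₂ / η ^ A₂ ≤ Real.log N ^ A₀ * ρ₁ ^ 2 * (ℓ : ℝ) ^ 4 := by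
  have hC₂pos : 0 < C₂ := by linarith
  -- constants: `b = A₂ + 1`, `c'' = min (cη^{A₂}/C₂) 1`, `K₂ = C₂ / cη^{A₂}`
  set b : ℕ := A₂ + 1 with hb
  set c'' : ℝ := min (cη ^ A₂ / C₂) 1 with hc''
  have hc''pos : 0 < c'' := lt_min (by positivity) one_pos
  have hc''le : c'' ≤ cη ^ A₂ / C₂ := min_le_left _ _
  have hc''1 : c'' ≤ 1 := min_le_right _ _
  set K₂ : ℝ := C₂ / cη ^ A₂ with hK₂
  have hK₂pos : 0 < K₂ := by rw [hK₂]; positivity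
  set e₁ : ℕ := (k + 2) * (4 + 4 ^ (k + 2)) with he₁
  have he₁1 : 1 ≤ e₁ := by
    have : 0 < e₁ := by rw [he₁]; positivity
    omega
  set Kk : ℝ := 16 ^ (k + 2) * (32 * 38 ^ k) with hKk
  have hKk16 : 16 ≤ Kk := by
    rw [hKk]
    have h1 : (16 : ℝ) ≤ 16 ^ (k + 2) := by
      calc (16 : ℝ) = 16 ^ 1 := (pow_one _).symm
        _ ≤ 16 ^ (k + 2) := pow_le_pow_right₀ (by norm_num) (by omega)
    have h2 : (1 : ℝ) ≤ 32 * 38 ^ k := by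
      have := one_le_pow₀ (M₀ := ℝ) (a := 38) (n := k) (by norm_num); linarith
    nlinarith
  have hKkpos : 0 < Kk := by linarith
  refine ⟨aη * ((5 * b : ℕ) : ℝ) + 4 * aη * ((b : ℕ) : ℝ) + 2, ?_⟩
  intro A₀ hA₀
  have hbr : (1 : ℝ) ≤ ((b : ℕ) : ℝ) := by exact_mod_cast (by omega : 1 ≤ b)
  have hA₀5 : aη * ((5 * b : ℕ) : ℝ) + 1 ≤ A₀ := by nlinarith
  have hA₀4 : 4 * aη * ((b : ℕ) : ℝ) + 2 ≤ A₀ := by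
    have : 0 ≤ aη * ((5 * b : ℕ) : ℝ) := by positivity
    linarith
  have hA₀1 : aη + 1 ≤ A₀ := by nlinarith
  have hA₀pos : 0 < A₀ := by linarith
  -- threshold from `log^r x = o(x^{1/4})`, `r = A₀ e₁ (k+1)`
  have hlo := (isLittleO_log_rpow_rpow_atTop (A₀ * ((e₁ * (k + 1) : ℕ) : ℝ))
    (by norm_num : (0 : ℝ) < 1 / 4)).bound (show (0 : ℝ) < 1 / (4 * Kk) by positivity)
  obtain ⟨T, hT⟩ := eventually_atTop.mp hlo
  set Mlog : ℝ := max 4 (max K₂ (max (20 * K₂ / c'') (160000 * K₂ / c'' ^ 4))) with hMlog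
  refine ⟨⌈max T (Real.exp Mlog)⌉₊, ?_⟩
  intro N hN h2N ρ η hρ hρ1 hρa hηc hη1 ρ₁ hρ₁
  -- thresholds at `N`
  have hN' : max T (Real.exp Mlog) ≤ N := (Nat.le_ceil _).trans (by exact_mod_cast hN)
  have hTN : T ≤ N := (le_max_left _ _).trans hN'
  have hexpN : Real.exp Mlog ≤ N := (le_max_right _ _).trans hN'
  have hNpos : (0 : ℝ) < N := lt_of_lt_of_le (Real.exp_pos _) hexpN
  have hN1 : 1 ≤ N := by omega
  have hlogM : Mlog ≤ Real.log N := by rw [Real.le_log_iff_exp_le hNpos]; exact hexpN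
  have hlog4 : 4 ≤ Real.log N := le_trans (le_max_left _ _) hlogM
  have hK₂log : K₂ ≤ Real.log N := le_trans ((le_max_left _ _).trans (le_max_right _ _)) hlogM
  have hK₃ : 20 * K₂ / c'' ≤ Real.log N :=
    le_trans ((le_max_left _ _).trans ((le_max_right _ _).trans (le_max_right _ _))) hlogM
  have hK₄ : 160000 * K₂ / c'' ^ 4 ≤ Real.log N :=
    le_trans ((le_max_right _ _).trans ((le_max_right _ _).trans (le_max_right _ _))) hlogM
  have hlog1 : 1 ≤ Real.log N := by linarith
  have hlogpos : 0 < Real.log N := by linarith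
  have hΛ1 : 1 ≤ Real.log N ^ aη := Real.one_le_rpow hlog1 haη.le
  have hΛpos : 0 < Real.log N ^ aη := by linarith
  have hP1 : 1 ≤ Real.log N ^ A₀ := Real.one_le_rpow hlog1 hA₀pos.le
  have hPpos : 0 < Real.log N ^ A₀ := by linarith
  have hP4 : 4 ≤ Real.log N ^ A₀ :=
    hlog4.trans (by
      calc Real.log N = Real.log N ^ (1 : ℝ) := (Real.rpow_one _).symm
        _ ≤ Real.log N ^ A₀ := Real.rpow_le_rpow_of_exponent_le hlog1 (by linarith))
  have hpowP : ∀ m : ℕ, aη * (m : ℝ) + 1 ≤ A₀ →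
      (Real.log N ^ aη) ^ m * Real.log N ≤ Real.log N ^ A₀ := by
    intro m hm
    have e : Real.log N ^ (aη * (m : ℝ) + 1) = (Real.log N ^ aη) ^ m * Real.log N := by
      rw [Real.rpow_add hlogpos, Real.rpow_mul_natCast hlogpos.le, Real.rpow_one]
    rw [← e]
    exact Real.rpow_le_rpow_of_exponent_le hlog1 hm
  -- `η`, `Qη = C₂/η^{A₂}`, `εη = η^{A₂}/C₂`
  have hηpos : 0 < η := lt_of_lt_of_le (by positivity) hηc
  have hηA : 0 < η ^ A₂ := by positivity
  have hηA1 : η ^ A₂ ≤ 1 := pow_le_one₀ hηpos.le hη1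
  have hQη1 : 1 ≤ C₂ / η ^ A₂ := by rw [le_div_iff₀ hηA, one_mul]; exact hηA1.trans hC₂
  have hQηpos : 0 < C₂ / η ^ A₂ := by positivity
  have hεη : η ^ A₂ / C₂ = (C₂ / η ^ A₂)⁻¹ := by rw [inv_div]
  have hεηpos : 0 < η ^ A₂ / C₂ := by positivity
  have hεη1 : η ^ A₂ / C₂ ≤ 1 := by rw [div_le_one hC₂pos]; linarith
  -- `Qη ≤ K₂ Λ^{A₂}`
  have hηΛ : cη ≤ η * Real.log N ^ aη := by
    have := mul_le_mul_of_nonneg_right hηc hΛpos.le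
    rwa [mul_assoc, inv_mul_cancel₀ hΛpos.ne', mul_one] at this
  have hηinv : (η ^ A₂)⁻¹ ≤ (Real.log N ^ aη) ^ A₂ / cη ^ A₂ := by
    rw [le_div_iff₀ (by positivity)]
    have h1 : cη ^ A₂ ≤ η ^ A₂ * (Real.log N ^ aη) ^ A₂ := by
      rw [← mul_pow]; exact pow_le_pow_left₀ hcη.le hηΛ A₂
    calc (η ^ A₂)⁻¹ * cη ^ A₂ ≤ (η ^ A₂)⁻¹ * (η ^ A₂ * (Real.log N ^ aη) ^ A₂) :=
          mul_le_mul_of_nonneg_left h1 (by positivity)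
      _ = (Real.log N ^ aη) ^ A₂ := by rw [← mul_assoc, inv_mul_cancel₀ hηA.ne', one_mul]
  have hQηK₂ : C₂ / η ^ A₂ ≤ K₂ * (Real.log N ^ aη) ^ A₂ := by
    rw [div_eq_mul_inv, hK₂]
    calc C₂ * (η ^ A₂)⁻¹ ≤ C₂ * ((Real.log N ^ aη) ^ A₂ / cη ^ A₂) :=
          mul_le_mul_of_nonneg_left hηinv hC₂pos.le
      _ = C₂ / cη ^ A₂ * (Real.log N ^ aη) ^ A₂ := by ring
  -- `ε' = min εη ρ` and its lower bound `c'' Λ^{-b} ≤ ε'`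
  obtain ⟨ε', hε'⟩ : ∃ ε' : ℝ, ε' = min (η ^ A₂ / C₂) ρ := ⟨_, rfl⟩
  have hε'pos : 0 < ε' := by rw [hε']; exact lt_min hεηpos hρ
  have hε'ε : ε' ≤ η ^ A₂ / C₂ := by rw [hε']; exact min_le_left _ _
  have hε'ρ : ε' ≤ ρ := by rw [hε']; exact min_le_right _ _
  have hε'1 : ε' ≤ 1 := hε'ε.trans hεη1
  have hΛb : (Real.log N ^ aη) ^ A₂ ≤ (Real.log N ^ aη) ^ b :=
    pow_le_pow_right₀ hΛ1 (by omega)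
  have hΛb1 : 1 ≤ (Real.log N ^ aη) ^ b := one_le_pow₀ hΛ1
  have hε'low : c'' * ((Real.log N ^ aη) ^ b)⁻¹ ≤ ε' := by
    rw [hε']
    refine le_min ?_ ?_
    · -- `c'' Λ^{-b} ≤ cη^{A₂}/C₂ · Λ^{-A₂} ≤ η^{A₂}/C₂`
      have h1 : cη ^ A₂ / C₂ * ((Real.log N ^ aη) ^ A₂)⁻¹ ≤ η ^ A₂ / C₂ := by
        -- from `cη^{A₂} ≤ (η Λ)^{A₂}`
        have h2 : cη ^ A₂ ≤ η ^ A₂ * (Real.log N ^ aη) ^ A₂ := by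
          rw [← mul_pow]; exact pow_le_pow_left₀ hcη.le hηΛ A₂
        rw [div_mul_eq_mul_div, div_le_div_iff₀ (by positivity) hC₂pos]
        calc cη ^ A₂ * ((Real.log N ^ aη) ^ A₂)⁻¹ * C₂
            ≤ η ^ A₂ * (Real.log N ^ aη) ^ A₂ * ((Real.log N ^ aη) ^ A₂)⁻¹ * C₂ := by
              gcongr
          _ = η ^ A₂ * C₂ := by rw [mul_inv_cancel_right₀ (by positivity)]
      calc c'' * ((Real.log N ^ aη) ^ b)⁻¹ ≤ (cη ^ A₂ / C₂) * ((Real.log N ^ aη) ^ A₂)⁻¹ :=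
            mul_le_mul hc''le (inv_anti₀ (by positivity) hΛb) (by positivity) (by positivity)
        _ ≤ η ^ A₂ / C₂ := h1
    · calc c'' * ((Real.log N ^ aη) ^ b)⁻¹ ≤ 1 * (Real.log N ^ aη)⁻¹ := by
            refine mul_le_mul hc''1 (inv_anti₀ hΛpos ?_) (by positivity) zero_le_one
            calc Real.log N ^ aη = (Real.log N ^ aη) ^ 1 := (pow_one _).symm
              _ ≤ (Real.log N ^ aη) ^ b := pow_le_pow_right₀ hΛ1 (by omega)
        _ ≤ ρ := by rw [one_mul]; exact hρa
  -- `ρ₁`, `√ρ₁`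
  have hρ₁pos : 0 < ρ₁ := by rw [hρ₁]; positivity
  have hρ₁P : ρ₁ ≤ (Real.log N ^ A₀)⁻¹ := by
    rw [hρ₁]
    apply inv_anti₀ hPpos
    calc Real.log N ^ A₀ = (Real.log N ^ A₀) ^ 1 := (pow_one _).symm
      _ ≤ (Real.log N ^ A₀) ^ ((k + 2) * (4 + 4 ^ (k + 2))) :=
          pow_le_pow_right₀ hP1 (by rw [← he₁]; exact he₁1)
  have hρ₁1 : ρ₁ ≤ 1 := hρ₁P.trans (inv_le_one_of_one_le₀ hP1)
  obtain ⟨σ, hσ⟩ : ∃ σ : ℝ, σ = Real.sqrt ρ₁ := ⟨_, rfl⟩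
  have hσpos : 0 < σ := by rw [hσ]; exact Real.sqrt_pos.mpr hρ₁pos
  have hσσ : σ * σ = ρ₁ := by rw [hσ]; exact Real.mul_self_sqrt hρ₁pos.le
  have hσ1 : σ ≤ 1 := by
    rw [hσ]
    calc Real.sqrt ρ₁ ≤ Real.sqrt 1 := Real.sqrt_le_sqrt hρ₁1
      _ = 1 := Real.sqrt_one
  -- `σ ≤ P^{-1/2}`-type bound: `σ² = ρ₁ ≤ P⁻¹`, used as `σ · X ≤ 1` for `X² ≤ P`
  -- the two polylog smallness facts for `σ`:
  -- (S1) `20 K₂ Λ^{2b} σ ≤ c''`  and it implies `2 Qη ≤ ε'/(10σ)`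
  have hPhalf : (Real.log N ^ aη) ^ (4 * b) * Real.log N ^ 2 ≤ Real.log N ^ A₀ := by
    -- `Λ^{4b} (log N)^2 = (log N)^{4 aη b + 2} ≤ (log N)^{A₀}`
    have e : Real.log N ^ (aη * ((4 * b : ℕ) : ℝ) + 2) =
        (Real.log N ^ aη) ^ (4 * b) * Real.log N ^ 2 := by
      rw [Real.rpow_add hlogpos, Real.rpow_mul_natCast hlogpos.le]
      norm_cast
    rw [← e]
    refine Real.rpow_le_rpow_of_exponent_le hlog1 ?_
    push_cast; linarith
  have hS1 : 20 * K₂ * (Real.log N ^ aη) ^ (2 * b) * σ ≤ c'' := by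
    -- square both sides: `(20K₂ Λ^{2b})² σ² ≤ c''²` ⟸ `(20K₂)² Λ^{4b} ρ₁ ≤ c''²`,
    -- and `ρ₁ ≤ P⁻¹ ≤ ((log N)² Λ^{4b})⁻¹`, `(20K₂/c'')² ≤ (log N)²`.
    have h1 : 0 ≤ 20 * K₂ * (Real.log N ^ aη) ^ (2 * b) * σ := by positivity
    rw [← abs_of_nonneg h1, ← abs_of_nonneg hc''pos.le, ← sq_le_sq]
    have h2 : (20 * K₂ / c'') ^ 2 ≤ Real.log N ^ 2 :=
      pow_le_pow_left₀ (by positivity) hK₃ 2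
    have h3 : ρ₁ * ((Real.log N ^ aη) ^ (4 * b) * Real.log N ^ 2) ≤ 1 := by
      calc ρ₁ * ((Real.log N ^ aη) ^ (4 * b) * Real.log N ^ 2)
          ≤ (Real.log N ^ A₀)⁻¹ * Real.log N ^ A₀ :=
            mul_le_mul hρ₁P hPhalf (by positivity) (by positivity)
        _ = 1 := inv_mul_cancel₀ hPpos.ne'
    have e : (20 * K₂ * (Real.log N ^ aη) ^ (2 * b) * σ) ^ 2 =
        (20 * K₂) ^ 2 * (ρ₁ * (Real.log N ^ aη) ^ (4 * b)) := by
      rw [← hσσ, show (4 * b) = (2 * b) * 2 by ring, pow_mul]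
      ring
    rw [e]
    rw [div_pow, div_le_iff₀ (by positivity)] at h2
    -- `(20K₂)² ≤ (log N)² c''²`
    calc (20 * K₂) ^ 2 * (ρ₁ * (Real.log N ^ aη) ^ (4 * b))
        ≤ Real.log N ^ 2 * c'' ^ 2 * (ρ₁ * (Real.log N ^ aη) ^ (4 * b)) :=
          mul_le_mul_of_nonneg_right h2 (by positivity)
      _ = c'' ^ 2 * (ρ₁ * ((Real.log N ^ aη) ^ (4 * b) * Real.log N ^ 2)) := by ring
      _ ≤ c'' ^ 2 * 1 := mul_le_mul_of_nonneg_left h3 (by positivity)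
      _ = c'' ^ 2 := mul_one _
  -- `x = ε'/(10σ) ≥ 2 Qη ≥ 2`
  obtain ⟨x, hx⟩ : ∃ x : ℝ, x = ε' / (10 * σ) := ⟨_, rfl⟩
  have hxpos : 0 < x := by rw [hx]; positivity
  have hxQ : 2 * (C₂ / η ^ A₂) ≤ x := by
    rw [hx, le_div_iff₀ (by positivity)]
    -- `20 Qη σ ≤ ε'` ⟸ `20 K₂ Λ^{A₂} σ ≤ c'' Λ^{-b}` ⟸ hS1
    have h1 : 2 * (C₂ / η ^ A₂) * (10 * σ) ≤ 20 * K₂ * (Real.log N ^ aη) ^ A₂ * σ := by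
      have := mul_le_mul_of_nonneg_right hQηK₂ (show (0 : ℝ) ≤ 20 * σ by positivity)
      calc 2 * (C₂ / η ^ A₂) * (10 * σ) = C₂ / η ^ A₂ * (20 * σ) := by ring
        _ ≤ K₂ * (Real.log N ^ aη) ^ A₂ * (20 * σ) := this
        _ = 20 * K₂ * (Real.log N ^ aη) ^ A₂ * σ := by ring
    refine h1.trans ?_
    have h2 : 20 * K₂ * (Real.log N ^ aη) ^ A₂ * σ * (Real.log N ^ aη) ^ b ≤ c'' := by
      have h21 : 20 * K₂ * (Real.log N ^ aη) ^ A₂ * σ * (Real.log N ^ aη) ^ b =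
          (20 * K₂ * σ * (Real.log N ^ aη) ^ b) * (Real.log N ^ aη) ^ A₂ := by ring
      have h22 : 20 * K₂ * (Real.log N ^ aη) ^ (2 * b) * σ =
          (20 * K₂ * σ * (Real.log N ^ aη) ^ b) * (Real.log N ^ aη) ^ b := by
        rw [two_mul, pow_add]; ring
      calc 20 * K₂ * (Real.log N ^ aη) ^ A₂ * σ * (Real.log N ^ aη) ^ b
          = (20 * K₂ * σ * (Real.log N ^ aη) ^ b) * (Real.log N ^ aη) ^ A₂ := h21
        _ ≤ (20 * K₂ * σ * (Real.log N ^ aη) ^ b) * (Real.log N ^ aη) ^ b :=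
            mul_le_mul_of_nonneg_left hΛb (by positivity)
        _ = 20 * K₂ * (Real.log N ^ aη) ^ (2 * b) * σ := h22.symm
        _ ≤ c'' := hS1
    calc 20 * K₂ * (Real.log N ^ aη) ^ A₂ * σ
        = (20 * K₂ * (Real.log N ^ aη) ^ A₂ * σ * (Real.log N ^ aη) ^ b) *
            ((Real.log N ^ aη) ^ b)⁻¹ := by
          rw [mul_inv_cancel_right₀ (by positivity)]
      _ ≤ c'' * ((Real.log N ^ aη) ^ b)⁻¹ := mul_le_mul_of_nonneg_right h2 (by positivity)
      _ ≤ ε' := hε'low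
  have hx2 : 2 ≤ x := by linarith [hxQ, hQη1]
  -- `ℓ = ⌊x⌋`
  obtain ⟨ℓ, hℓ⟩ : ∃ ℓ : ℕ, ℓ = ⌊x⌋₊ := ⟨_, rfl⟩
  have hℓx : (ℓ : ℝ) ≤ x := by rw [hℓ]; exact Nat.floor_le hxpos.le
  have hℓlow : x / 2 ≤ ℓ := by
    have h1 : x < (ℓ : ℝ) + 1 := by rw [hℓ]; exact Nat.lt_floor_add_one x
    linarith
  have hℓ1 : 1 ≤ ℓ := by
    have : (1 : ℝ) ≤ ℓ := by linarith
    exact_mod_cast this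
  have hℓQ : C₂ / η ^ A₂ ≤ (ℓ : ℝ) := by linarith
  have hlarge : 4 * Kk * (Real.log N ^ A₀) ^ (e₁ * (k + 1)) ≤ (N : ℝ) ^ ((1 : ℝ) / 4) := by
    have h1 := hT N hTN
    rw [Real.norm_eq_abs, Real.norm_eq_abs, abs_of_nonneg (Real.rpow_nonneg hlogpos.le _),
      abs_of_nonneg (Real.rpow_nonneg hNpos.le _), Real.rpow_mul_natCast hlogpos.le] at h1
    rw [mul_comm]
    calc (Real.log N ^ A₀) ^ (e₁ * (k + 1)) * (4 * Kk)
        ≤ 1 / (4 * Kk) * (N : ℝ) ^ ((1 : ℝ) / 4) * (4 * Kk) :=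
          mul_le_mul_of_nonneg_right h1 (by positivity)
      _ = (N : ℝ) ^ ((1 : ℝ) / 4) := by field_simp
  have hPe1 : Real.log N ^ A₀ ≤ (Real.log N ^ A₀) ^ (e₁ * (k + 1)) := by
    calc Real.log N ^ A₀ = (Real.log N ^ A₀) ^ 1 := (pow_one _).symm
      _ ≤ (Real.log N ^ A₀) ^ (e₁ * (k + 1)) :=
          pow_le_pow_right₀ hP1 (he₁1.trans (Nat.le_mul_of_pos_right e₁ (by omega)))
  have hPe4 : 4 ≤ (Real.log N ^ A₀) ^ (e₁ * (k + 1)) := hP4.trans hPe1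
  -- `σ ≥ (P^{e₁(k+1)})⁻¹`: indeed `σ ≥ σ² = ρ₁ = (P^{e₁})⁻¹ ≥ (P^{e₁(k+1)})⁻¹`
  have hσlow : ((Real.log N ^ A₀) ^ (e₁ * (k + 1)))⁻¹ ≤ σ := by
    have h1 : ρ₁ ≤ σ := by
      calc ρ₁ = σ * σ := hσσ.symm
        _ ≤ σ * 1 := mul_le_mul_of_nonneg_left hσ1 hσpos.le
        _ = σ := mul_one _
    refine le_trans ?_ h1
    rw [hρ₁]
    apply inv_anti₀ (by positivity)
    exact pow_le_pow_right₀ hP1 (Nat.le_mul_of_pos_right e₁ (by omega))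
  have hℓν : (ℓ : ℝ) ^ 2 * ρ₁ ≤ min ((η ^ A₂ / C₂) ^ 2) ρ := by
    have h1 : (ℓ : ℝ) ^ 2 * ρ₁ ≤ ε' ^ 2 / 100 := by
      calc (ℓ : ℝ) ^ 2 * ρ₁ ≤ x ^ 2 * ρ₁ :=
            mul_le_mul_of_nonneg_right (pow_le_pow_left₀ (by positivity) hℓx 2) hρ₁pos.le
        _ = ε' ^ 2 / 100 := by rw [hx, ← hσσ]; field_simp; ring
    refine le_min (h1.trans ?_) (h1.trans ?_)
    · have := pow_le_pow_left₀ hε'pos.le hε'ε 2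
      have h0 : 0 ≤ (η ^ A₂ / C₂) ^ 2 := by positivity
      linarith
    · have h2 := pow_le_pow_left₀ hε'pos.le hε'ρ 2
      have h3 : ρ ^ 2 ≤ ρ := by
        rw [pow_two]; exact mul_le_of_le_one_right hρ.le (by linarith)
      linarith
  -- budget
  have hQP : C₂ / η ^ A₂ ≤ Real.log N ^ A₀ := by
    refine hQηK₂.trans ?_
    calc K₂ * (Real.log N ^ aη) ^ A₂ ≤ Real.log N * (Real.log N ^ aη) ^ A₂ :=
          mul_le_mul_of_nonneg_right hK₂log (by positivity)
      _ = (Real.log N ^ aη) ^ A₂ * Real.log N := mul_comm _ _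
      _ ≤ Real.log N ^ A₀ := hpowP A₂ (by
          have h1 : (A₂ : ℝ) ≤ ((5 * b : ℕ) : ℝ) := by exact_mod_cast (by omega : A₂ ≤ 5 * b)
          have h2 := mul_le_mul_of_nonneg_left h1 haη.le
          linarith)
  have hM₀ : C₂ / η ^ A₂ ≤ Real.log N ^ A₀ * ρ₁ ^ 2 * (ℓ : ℝ) ^ 4 := by
    -- `ρ₁² ℓ⁴ ≥ ρ₁² (x/2)⁴ = ε'⁴/160000`, `ε' ≥ c'' Λ^{-b}`, `Qη ≤ K₂ Λ^{b}`,
    -- `160000 K₂ / c''⁴ ≤ log N`, `Λ^{5b} log N ≤ P`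
    have h1 : ε' ^ 4 / 160000 ≤ ρ₁ ^ 2 * (ℓ : ℝ) ^ 4 := by
      have h2 : (x / 2) ^ 4 ≤ (ℓ : ℝ) ^ 4 := pow_le_pow_left₀ (by positivity) hℓlow 4
      calc ε' ^ 4 / 160000 = ρ₁ ^ 2 * (x / 2) ^ 4 := by
            rw [hx, ← hσσ]; field_simp; ring
        _ ≤ ρ₁ ^ 2 * (ℓ : ℝ) ^ 4 := mul_le_mul_of_nonneg_left h2 (by positivity)
    have h3 : c'' ^ 4 * ((Real.log N ^ aη) ^ b)⁻¹ ^ 4 ≤ ε' ^ 4 := by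
      have := pow_le_pow_left₀ (by positivity) hε'low 4
      rwa [mul_pow] at this
    have h4 : C₂ / η ^ A₂ ≤ K₂ * (Real.log N ^ aη) ^ b :=
      hQηK₂.trans (mul_le_mul_of_nonneg_left hΛb hK₂pos.le)
    have h5 : (Real.log N ^ aη) ^ (5 * b) * Real.log N ≤ Real.log N ^ A₀ := hpowP (5 * b) hA₀5
    have h6 : 160000 * K₂ ≤ c'' ^ 4 * Real.log N := by
      rw [div_le_iff₀ (by positivity)] at hK₄; linarith
    -- chain
    have h7 : C₂ / η ^ A₂ ≤ Real.log N ^ A₀ * (c'' ^ 4 * ((Real.log N ^ aη) ^ b)⁻¹ ^ 4) / 160000 := by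
      rw [le_div_iff₀ (by norm_num : (0:ℝ) < 160000)]
      calc C₂ / η ^ A₂ * 160000 ≤ K₂ * (Real.log N ^ aη) ^ b * 160000 :=
            mul_le_mul_of_nonneg_right h4 (by norm_num)
        _ = 160000 * K₂ * (Real.log N ^ aη) ^ b := by ring
        _ ≤ c'' ^ 4 * Real.log N * (Real.log N ^ aη) ^ b :=
            mul_le_mul_of_nonneg_right h6 (by positivity)
        _ = c'' ^ 4 * (((Real.log N ^ aη) ^ (5 * b) * Real.log N) *
              ((Real.log N ^ aη) ^ b)⁻¹ ^ 4) := by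
            have e5 : (Real.log N ^ aη) ^ (5 * b) =
                (Real.log N ^ aη) ^ b * ((Real.log N ^ aη) ^ b) ^ 4 := by ring
            have hb0 : ((Real.log N ^ aη) ^ b) ^ 4 * (((Real.log N ^ aη) ^ b) ^ 4)⁻¹ = 1 :=
              mul_inv_cancel₀ (by positivity)
            rw [e5, inv_pow]
            calc c'' ^ 4 * Real.log N * (Real.log N ^ aη) ^ b
                = c'' ^ 4 * Real.log N * (Real.log N ^ aη) ^ b *
                    (((Real.log N ^ aη) ^ b) ^ 4 * (((Real.log N ^ aη) ^ b) ^ 4)⁻¹) := by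
                  rw [hb0, mul_one]
              _ = _ := by ring
        _ ≤ c'' ^ 4 * (Real.log N ^ A₀ * ((Real.log N ^ aη) ^ b)⁻¹ ^ 4) := by
            gcongr
        _ = Real.log N ^ A₀ * (c'' ^ 4 * ((Real.log N ^ aη) ^ b)⁻¹ ^ 4) := by ring
    calc C₂ / η ^ A₂ ≤ Real.log N ^ A₀ * (c'' ^ 4 * ((Real.log N ^ aη) ^ b)⁻¹ ^ 4) / 160000 := h7
      _ ≤ Real.log N ^ A₀ * ε' ^ 4 / 160000 := by gcongr
      _ = Real.log N ^ A₀ * (ε' ^ 4 / 160000) := by ring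
      _ ≤ Real.log N ^ A₀ * (ρ₁ ^ 2 * (ℓ : ℝ) ^ 4) := mul_le_mul_of_nonneg_left h1 hPpos.le
      _ = Real.log N ^ A₀ * ρ₁ ^ 2 * (ℓ : ℝ) ^ 4 := by ring
  have hdens : 4 * ρ₁ ≤ Real.log N ^ A₀ := by linarith [hρ₁1, hP4]
  have hQPe : C₂ / η ^ A₂ ≤ (Real.log N ^ A₀) ^ (e₁ * (k + 1)) := by
    have h2 : 20 * K₂ * (Real.log N ^ aη) ^ (2 * b) * σ ≤ 1 := hS1.trans hc''1
    have h3 := mul_le_mul_of_nonneg_left hσlow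
      (show (0:ℝ) ≤ 20 * K₂ * (Real.log N ^ aη) ^ (2 * b) by positivity)
    have h4 : 20 * K₂ * (Real.log N ^ aη) ^ (2 * b) * ((Real.log N ^ A₀) ^ (e₁ * (k + 1)))⁻¹ ≤ 1 :=
      h3.trans h2
    rw [← div_eq_mul_inv, div_le_one (by positivity)] at h4
    calc C₂ / η ^ A₂ ≤ K₂ * (Real.log N ^ aη) ^ b :=
          hQηK₂.trans (mul_le_mul_of_nonneg_left hΛb hK₂pos.le)
      _ ≤ 20 * K₂ * (Real.log N ^ aη) ^ (2 * b) := by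
          have h5 : (Real.log N ^ aη) ^ b ≤ (Real.log N ^ aη) ^ (2 * b) :=
            pow_le_pow_right₀ hΛ1 (by omega)
          have h6 : K₂ * (Real.log N ^ aη) ^ b ≤ K₂ * (Real.log N ^ aη) ^ (2 * b) :=
            mul_le_mul_of_nonneg_left h5 hK₂pos.le
          have h7 : 0 ≤ K₂ * (Real.log N ^ aη) ^ (2 * b) := by positivity
          linarith
      _ ≤ (Real.log N ^ A₀) ^ (e₁ * (k + 1)) := h4
  exact ⟨hηpos, hρ₁pos, hdens, hQP, hQPe, hlarge, ℓ, σ, x, ε', hℓ1, hσpos, hσσ, hσ1, hσlow, hε'pos,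
    hε'ε, hx, hxpos, hℓx, hℓQ, hℓν, hM₀⟩

end Summit.Parity.GeneralizedHardyLittlewood.GreenTaoLevelTwoMNTwoTypeIIParams
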